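import Literature.Topology.FourManifolds.TrisectionFunctorGKStabilizationKernel
import Literature.Topology.FourManifolds.SurfaceGroupAmalgam
import Literature.Topology.FourManifolds.SurfaceGroupGenusOne
import HarnessLib

/-!
# Connected sum of kernel triples, the unbalanced stabilisation, and
# "balanced stabilisation = three unbalanced ones"

Topic `Literature/Topology/FourManifolds`; algebra for the fact seats
`provefact-Literature.Topology.FourManifolds.sphere-99d675ea90` (named fact (d′)
`Literature.Topology.FourManifolds.sphere_gkTrisections`) and
`provefact-Literature.Topology.FourManifolds.exists-14560f9fc8` (named fact (c′)
`Literature.Topology.FourManifolds.exists_stabilized_gkTrisection`).  Everything in this file is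
**proved**; the definitions are explicit (`genInclAdd`, `genShiftAdd`,
`TrisectionKernels.connectSum`, `unbalancedKernels`, `TrisectionKernels.stabilizeOne`); there are
no named facts.

## Why

Gay–Kirby prove their Lemma 10 (a stabilisation of a `(g, k)`-trisection is a
`(g + 3, k + 1)`-trisection) "one eye at a time" (arXiv p. 31): each of the three eyes removes a
neighbourhood of ONE boundary-parallel arc in ONE handlebody `H_i = X_j ∩ X_l` from `X_j`, `X_l`
and adds it to `X_i` — the *unbalanced* stabilisation, raising the genus by one and `k_i` by one.
The tree's geometric stabilisation follows this structure
(`TriNormalForm.exists_stabilization` = three implants, `TrisectionsStabilizationNF.lean`),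
whereas the algebraic stabilisation `TrisectionKernels.stabilize` (Abrams–Gay–Kirby, Def. 3:
connected sum with the genus-`3` triple `s4Kernels` of `S⁴`) is one balanced step.  This file
supplies the algebra matching the geometry:

* (over `SurfaceGroupAmalgam.lean`: `genInclAdd g g'`, `genShiftAdd g g'` — the first `g` and
  the last `g'` handles of `F⟨a₁, …, b_{g+g'}⟩`, `surfaceRelator_add`, and the pushout lemmas
  `surfaceGroup_hom_ext_add`, `surfaceGroup_exists_hom_add`,
  `surfaceGroup_exists_mulEquiv_of_pushout_add`; for `g' = 3` these are the tree's `genIncl`,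
  `genShift`, definitionally) `mk_genInclAdd_surfaceRelator_mul_mk_genShiftAdd`,
  `surfaceGroup_closure_range_union_eq_top_add` — `ι(r_g) σ(r_{g'}) = 1`, and `S_{g+g'}` is
  generated by the two sides;
* `TrisectionKernels.connectSum K L` — **Abrams–Gay–Kirby's connected sum of kernel triples**
  (Def. 2: `K # L`, slot by slot the normal closure of the lifts of `K_i` on the first `g`
  handles and of `L_i` on the last `g'`), with `K.stabilize = K.connectSum s4Kernels`
  (`TrisectionKernels.stabilize_eq_connectSum`, `rfl`);
* `surfaceGroup_ker_eq_connectSum` — the kernel of `S_{g+g'} → A′ ∗ B′` induced by surjections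
  `F_{2g} ↠ A′`, `F_{2g'} ↠ B′` with kernels `mk⁻¹ K_i`, `mk⁻¹ L_i` is `(K # L)_i` on the nose
  (the engine `ker_eq_normalClosure_of_coprod_of_surjective` of the sibling file);
* `TrisectionKernels.connectSum_apply_eq_of_preimage_eq`, `preimage_mk_connectSum` — normal
  generators of `(K # L)_i` and of its preimage in the free group, when `mk⁻¹ L_i` is given by
  normal generators;
* `unbalancedKernels i : TrisectionKernels 1` — the kernel triple of the genus-`1` unbalanced
  trisection of `S⁴` stabilising sector `i`: with `S_1 = ⟨a, b ∣ [a, b]⟩`, slot `i` kills `b`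
  (the arc closed up in `F` bounds in `H_i ∖ N̊`) and the two other slots kill `a` (the meridian
  of the tube bounds the cocore disc of the `1`-handle added to `H_j`, `H_l`);
  `TrisectionKernels.stabilizeOne K i = K # unbalancedKernels i`;
* `TrisectionKernels.stabilize_eq_stabilizeOne` — **the balanced stabilisation is three
  unbalanced ones**: `K.stabilize = ((K.stabilizeOne 2).stabilizeOne 1).stabilizeOne 0` ON THE
  NOSE (the genus-`3` triple of `S⁴`, `⟪a₁,a₂,b₃⟫, ⟪a₁,b₂,a₃⟫, ⟪b₁,a₂,a₃⟫`, kills `b` of the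
  first new handle in slot `2`, of the second in slot `1`, of the third in slot `0`).

With these, the `π₁` stage of ONE implant (genus `g ↦ g + 1`) can be run three times and the
result read as `K.stabilize`, which is what the induction for (d′)
(`sphere_gkTrisections_of_invariant_step`) consumes.

## References

* D. Gay, R. Kirby, *Trisecting 4-manifolds*, Geom. Topol. 20 (2016) 3097–3132
  (arXiv:1205.1565): Def. 8 (arXiv p. 4), Lemma 10 and its proof (arXiv pp. 31–32, Figs. 27–28:
  "We see that the claim is true one eye at a time … we have simply removed a neighborhood of an
  arc in `H₃₁` from both `X₁` and `X₃` and added it to `X₂`. Repeat this for each of the three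
  eyes."), §2 and Fig. 3 (the genus-`3` trisection of `S⁴`). [GayKirby2016]
* A. Abrams, D. Gay, R. Kirby, *Group trisections and smooth 4-manifolds*, Geom. Topol. 22
  (2018) 1537–1545: Def. 2 (connected sum of group trisections, p. 1539), Def. 3 (stabilisation,
  p. 1540), Fig. 1. [AbramsGayKirby2018]
* A. Hatcher, *Algebraic Topology*, CUP (2002): Thm. 1.20. [HatcherAT2002]
-/

noncomputable section

open Set Subgroup

namespace Literature.Topology.FourManifolds

universe u

/-! ### Two complements on `S_{g+g'}` as the pushout `F_{2g} ∗_ℤ F_{2g'}` (`SurfaceGroupAmalgam.lean`) -/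

section Pushout

variable {g g' : ℕ}

/-- `ι(r_g) · σ(r_{g'}) = 1` in `S_{g+g'}`. [folklore] -/
theorem mk_genInclAdd_surfaceRelator_mul_mk_genShiftAdd (g g' : ℕ) :
    PresentedGroup.mk ({surfaceRelator (g + g')} : Set (FreeGroup (surfaceGen (g + g'))))
        (genInclAdd g g' (surfaceRelator g)) *
      PresentedGroup.mk ({surfaceRelator (g + g')} : Set (FreeGroup (surfaceGen (g + g'))))
        (genShiftAdd g g' (surfaceRelator g')) = 1 := by
  rw [← map_mul, ← surfaceRelator_add, PresentedGroup.mk_eq_one_iff]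
  exact subset_normalClosure rfl

/-- `S_{g+g'}` is generated by the images of `ι` and `σ`. [folklore] -/
theorem surfaceGroup_closure_range_union_eq_top_add :
    Subgroup.closure (Set.range ((PresentedGroup.mk _).comp (genInclAdd g g')) ∪
      Set.range ((PresentedGroup.mk _).comp (genShiftAdd g g'))) =
      (⊤ : Subgroup (SurfaceGroup (g + g'))) := by
  rw [eq_top_iff, ← PresentedGroup.closure_range_of, Subgroup.closure_le]
  rintro _ ⟨p, rfl⟩
  refine Subgroup.subset_closure ?_
  rcases of_eq_genInclAdd_or_genShiftAdd p with ⟨q, hq⟩ | ⟨q, hq⟩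
  · refine Or.inl ⟨FreeGroup.of q, ?_⟩
    change PresentedGroup.mk _ (genInclAdd g g' (FreeGroup.of q)) = _
    rw [← hq]
    rfl
  · refine Or.inr ⟨FreeGroup.of q, ?_⟩
    change PresentedGroup.mk _ (genShiftAdd g g' (FreeGroup.of q)) = _
    rw [← hq]
    rfl

end Pushout

/-! ### Abrams–Gay–Kirby's connected sum of kernel triples -/

section ConnectSum

variable {g g' : ℕ}

/-- **Connected sum of kernel triples** (Abrams–Gay–Kirby 2018, Def. 2: the connected sum
`{G_κ} # {G′_κ}` is the push-out cube whose kernels are generated by those of the summands; on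
kernel triples: in `S_{g+g'}`, the `i`-th kernel of `K # L` is the normal closure of the lifts
of `K_i` placed on the first `g` handles together with the lifts of `L_i` placed on the last
`g'`).  `K.stabilize` is `K # s4Kernels` (`TrisectionKernels.stabilize_eq_connectSum`).
[cite: AbramsGayKirby2018, Def. 2 (p. 1539)] -/
def TrisectionKernels.connectSum (K : TrisectionKernels g) (L : TrisectionKernels g') :
    TrisectionKernels (g + g') :=
  fun i => normalClosure
    ((PresentedGroup.mk _ ∘ genInclAdd g g') ''
        ((PresentedGroup.mk _) ⁻¹' (K i : Set (SurfaceGroup g))) ∪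
      (PresentedGroup.mk _ ∘ genShiftAdd g g') ''
        ((PresentedGroup.mk _) ⁻¹' (L i : Set (SurfaceGroup g'))))

/-- Unfolding `connectSum`. [folklore] -/
theorem TrisectionKernels.connectSum_apply (K : TrisectionKernels g) (L : TrisectionKernels g')
    (i : Fin 3) :
    K.connectSum L i = normalClosure
      ((PresentedGroup.mk _ ∘ genInclAdd g g') ''
          ((PresentedGroup.mk _) ⁻¹' (K i : Set (SurfaceGroup g))) ∪
        (PresentedGroup.mk _ ∘ genShiftAdd g g') ''
          ((PresentedGroup.mk _) ⁻¹' (L i : Set (SurfaceGroup g')))) := rfl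

/-- Each slot of a connected sum is a normal subgroup. [folklore] -/
instance TrisectionKernels.connectSum_normal (K : TrisectionKernels g) (L : TrisectionKernels g')
    (i : Fin 3) : (K.connectSum L i).Normal := by
  rw [TrisectionKernels.connectSum_apply]
  infer_instance

/-- **Stabilisation is the connected sum with the genus-`3` triple of `S⁴`**
(Abrams–Gay–Kirby, Def. 3), definitionally. [cite: AbramsGayKirby2018, Def. 3 (p. 1540)] -/
theorem TrisectionKernels.stabilize_eq_connectSum (K : TrisectionKernels g) :
    K.stabilize = K.connectSum s4Kernels := rfl

variable {Λ A' B' : Type*} [Group Λ] [Group A'] [Group B']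

/-- **The kernel is the connected sum on the nose.**  Let `ρ : S_{g+g'} → Λ` factor on the first
`g` handles as `ρ ∘ ι = j_A ∘ a` and on the last `g'` as `ρ ∘ σ = j_B ∘ b`, where `j_A`, `j_B`
present `Λ` as a free product `A′ ∗ B′` (existence half of the universal property) and
`a : F⟨a₁,…,b_g⟩ ↠ A′`, `b : F⟨a₁,…,b_{g'}⟩ ↠ B′` are surjections whose kernels are the full
preimages of `K_i ⊆ S_g` and of `L_i ⊆ S_{g'}`.  Then `ker ρ = (K # L)_i`
(`ker_eq_normalClosure_of_coprod_of_surjective`).  In the application to one unbalanced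
stabilisation, `Λ = π₁(H′_i)`, `A′ = π₁(H_i ∖ half-ball) = π₁(H_i)`, `B′ = π₁` of the genus-`1`
chunk, `L = unbalancedKernels _`. [cite: AbramsGayKirby2018, Def. 2–3 (pp. 1539–1540)] -/
theorem surfaceGroup_ker_eq_connectSum (K : TrisectionKernels g) (L : TrisectionKernels g')
    (i : Fin 3) (ρ : SurfaceGroup (g + g') →* Λ) (jA : A' →* Λ) (jB : B' →* Λ)
    (hcop : ∀ (T : Type) [Group T] (f : A' →* T) (f' : B' →* T),
      ∃ Φ : Λ →* T, Φ.comp jA = f ∧ Φ.comp jB = f')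
    (a : FreeGroup (surfaceGen g) →* A') (b : FreeGroup (surfaceGen g') →* B')
    (ha : Function.Surjective a) (hb : Function.Surjective b)
    (hka : (a.ker : Set (FreeGroup (surfaceGen g))) =
      PresentedGroup.mk _ ⁻¹' (K i : Set (SurfaceGroup g)))
    (hkb : (b.ker : Set (FreeGroup (surfaceGen g'))) =
      PresentedGroup.mk _ ⁻¹' (L i : Set (SurfaceGroup g')))
    (hA : ρ.comp ((PresentedGroup.mk _).comp (genInclAdd g g')) = jA.comp a)
    (hB : ρ.comp ((PresentedGroup.mk _).comp (genShiftAdd g g')) = jB.comp b) :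
    ρ.ker = K.connectSum L i := by
  rw [ker_eq_normalClosure_of_coprod_of_surjective _ _ surfaceGroup_closure_range_union_eq_top_add
    ρ jA jB hcop a b ha hb hA hB, hka, hkb, TrisectionKernels.connectSum_apply]
  rfl

/-- The same with the free product structure on `Λ` given by an isomorphism `e : Λ ≃* A′ ∗ B′`
carrying `j_A`, `j_B` to the canonical inclusions. [cite: AbramsGayKirby2018, Def. 2–3 (pp. 1539–1540)] -/
theorem surfaceGroup_ker_eq_connectSum_of_mulEquiv (K : TrisectionKernels g)
    (L : TrisectionKernels g') (i : Fin 3) (ρ : SurfaceGroup (g + g') →* Λ) (jA : A' →* Λ)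
    (jB : B' →* Λ) (e : Λ ≃* Monoid.Coprod A' B')
    (heA : e.toMonoidHom.comp jA = Monoid.Coprod.inl)
    (heB : e.toMonoidHom.comp jB = Monoid.Coprod.inr)
    (a : FreeGroup (surfaceGen g) →* A') (b : FreeGroup (surfaceGen g') →* B')
    (ha : Function.Surjective a) (hb : Function.Surjective b)
    (hka : (a.ker : Set (FreeGroup (surfaceGen g))) =
      PresentedGroup.mk _ ⁻¹' (K i : Set (SurfaceGroup g)))
    (hkb : (b.ker : Set (FreeGroup (surfaceGen g'))) =
      PresentedGroup.mk _ ⁻¹' (L i : Set (SurfaceGroup g')))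
    (hA : ρ.comp ((PresentedGroup.mk _).comp (genInclAdd g g')) = jA.comp a)
    (hB : ρ.comp ((PresentedGroup.mk _).comp (genShiftAdd g g')) = jB.comp b) :
    ρ.ker = K.connectSum L i := by
  refine surfaceGroup_ker_eq_connectSum K L i ρ jA jB ?_ a b ha hb hka hkb hA hB
  intro T _ f f'
  refine ⟨(Monoid.Coprod.lift f f').comp e.toMonoidHom, ?_, ?_⟩
  · rw [MonoidHom.comp_assoc, heA, Monoid.Coprod.lift_comp_inl]
  · rw [MonoidHom.comp_assoc, heB, Monoid.Coprod.lift_comp_inr]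

end ConnectSum

/-! ### Normal generators of a connected sum -/

section Generators

variable {G G₁ : Type*} [Group G] [Group G₁]

/-- `⟪f(⟪U⟫) ∪ V⟫ = ⟪f(U) ∪ V⟫`: inside a normal closure, a set pushed forward along a
homomorphism may be replaced by its normal generators. [folklore] -/
theorem normalClosure_image_normalClosure_union (f : G₁ →* G) (U : Set G₁) (V : Set G) :
    normalClosure (f '' (normalClosure U : Set G₁) ∪ V) = normalClosure (f '' U ∪ V) := by
  apply le_antisymm
  · refine normalClosure_le_normal (Set.union_subset ?_ ?_)
    · rintro _ ⟨x, hx, rfl⟩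
      have h1 : (normalClosure U).map f ≤ normalClosure (f '' U ∪ V) :=
        (map_normalClosure_le U f).trans (normalClosure_mono Set.subset_union_left)
      exact h1 ⟨x, hx, rfl⟩
    · exact fun y hy => subset_normalClosure (Or.inr hy)
  · exact normalClosure_mono (Set.union_subset_union_left _
      (Set.image_mono subset_normalClosure))

/-- `⟪S ∪ {y}⟫ = ⟪S⟫` when `y ∈ ⟪S⟫`. [folklore] -/
theorem normalClosure_union_singleton_eq_of_mem {S : Set G} {y : G} (hy : y ∈ normalClosure S) :
    normalClosure (S ∪ {y}) = normalClosure S := by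
  apply le_antisymm
  · exact normalClosure_le_normal (Set.union_subset subset_normalClosure
      (Set.singleton_subset_iff.2 hy))
  · exact normalClosure_mono Set.subset_union_left

/-- `⟪S ∪ T⟫ = ⟪S⟫` when `T ⊆ ⟪S⟫`. [folklore] -/
theorem normalClosure_union_eq_of_subset {S T : Set G} (hT : T ⊆ normalClosure S) :
    normalClosure (S ∪ T) = normalClosure S := by
  apply le_antisymm
  · exact normalClosure_le_normal (Set.union_subset subset_normalClosure hT)
  · exact normalClosure_mono Set.subset_union_left

/-- A commutator `a b a⁻¹ b⁻¹` lies in the normal closure of `{a}`. [folklore] -/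
theorem mul_mul_inv_mul_inv_mem_normalClosure_left (a b : G) :
    a * b * a⁻¹ * b⁻¹ ∈ normalClosure ({a} : Set G) := by
  have ha : a ∈ normalClosure ({a} : Set G) := subset_normalClosure (Set.mem_singleton a)
  have h2 : b * a⁻¹ * b⁻¹ ∈ normalClosure ({a} : Set G) := by
    have := (normalClosure_normal (s := ({a} : Set G))).conj_mem _ (inv_mem ha) b
    simpa [mul_assoc] using this
  simpa [mul_assoc] using mul_mem ha h2

/-- A commutator `a b a⁻¹ b⁻¹` lies in the normal closure of `{b}`. [folklore] -/
theorem mul_mul_inv_mul_inv_mem_normalClosure_right (a b : G) :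
    a * b * a⁻¹ * b⁻¹ ∈ normalClosure ({b} : Set G) := by
  have hb : b ∈ normalClosure ({b} : Set G) := subset_normalClosure (Set.mem_singleton b)
  have h1 : a * b * a⁻¹ ∈ normalClosure ({b} : Set G) :=
    (normalClosure_normal (s := ({b} : Set G))).conj_mem _ hb a
  exact mul_mem h1 (inv_mem hb)

variable {g g' : ℕ}

/-- **Normal generators of a connected sum.**  If the preimage of `L_i` in the free group is the
normal closure of a set `T_L` of words (e.g. cut curves and the boundary word), then
`(K # L)_i` is the normal closure of the lifts of `K_i` on the first `g` handles together with
the words of `T_L` on the last `g'`. [cite: AbramsGayKirby2018, Def. 2 (p. 1539)] -/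
theorem TrisectionKernels.connectSum_apply_eq_of_preimage_eq (K : TrisectionKernels g)
    (L : TrisectionKernels g') (i : Fin 3) {TL : Set (FreeGroup (surfaceGen g'))}
    (hL : (PresentedGroup.mk _) ⁻¹' (L i : Set (SurfaceGroup g')) =
      (normalClosure TL : Set (FreeGroup (surfaceGen g')))) :
    K.connectSum L i = normalClosure
      ((PresentedGroup.mk _ ∘ genInclAdd g g') ''
          ((PresentedGroup.mk _) ⁻¹' (K i : Set (SurfaceGroup g))) ∪
        (PresentedGroup.mk _ ∘ genShiftAdd g g') '' TL) := by
  rw [TrisectionKernels.connectSum_apply, hL, Set.union_comm, ← MonoidHom.coe_comp,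
    normalClosure_image_normalClosure_union, Set.union_comm, MonoidHom.coe_comp]

/-- **The preimage of a connected-sum kernel in the free group**: under the hypothesis of
`connectSum_apply_eq_of_preimage_eq`, the preimage of `(K # L)_i` in `F⟨a₁, …, b_{g+g'}⟩` is
the normal closure of `ι(mk⁻¹ K_i) ∪ σ(T_L) ∪ {r_{g+g'}}` (`comap_mk_normalClosure_image`).
[cite: AbramsGayKirby2018, Def. 2 (p. 1539)] -/
theorem TrisectionKernels.preimage_mk_connectSum (K : TrisectionKernels g)
    (L : TrisectionKernels g') (i : Fin 3) {TL : Set (FreeGroup (surfaceGen g'))}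
    (hL : (PresentedGroup.mk _) ⁻¹' (L i : Set (SurfaceGroup g')) =
      (normalClosure TL : Set (FreeGroup (surfaceGen g')))) :
    (PresentedGroup.mk _) ⁻¹' (K.connectSum L i : Set (SurfaceGroup (g + g'))) =
      (normalClosure (genInclAdd g g' '' ((PresentedGroup.mk _) ⁻¹' (K i : Set (SurfaceGroup g))) ∪
          genShiftAdd g g' '' TL ∪ {surfaceRelator (g + g')}) :
        Set (FreeGroup (surfaceGen (g + g')))) := by
  rw [K.connectSum_apply_eq_of_preimage_eq L i hL, Set.image_comp, Set.image_comp,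
    ← Set.image_union, ← Subgroup.coe_comap, comap_mk_normalClosure_image]

end Generators

/-! ### The unbalanced stabilisation -/

section Unbalanced

variable {g : ℕ}

/-- **The kernel triple of the genus-`1` unbalanced trisection of `S⁴` stabilising sector `i`.**
With `S_1 = ⟨a, b ∣ [a, b]⟩` (`a = (0, false)`, `b = (0, true)`): slot `i` is `⟪b⟫` and the two
other slots are `⟪a⟫`.  Geometrically (Gay–Kirby, proof of Lemma 10, one eye: a neighbourhood
`N` of a boundary-parallel arc in `H_i = X_j ∩ X_l` is removed from `X_j`, `X_l` and added to
`X_i`): the new handle of the central surface carries the meridian `a` of the tube `∂N ∩ F′`,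
which bounds the cocore disc of the `1`-handle added to `H_j` and to `H_l`, and the arc closed up
through `F`, `b`, which bounds in `H_i ∖ N̊`.  The balanced genus-`3` triple `s4Kernels` of `S⁴`
(Gay–Kirby, Fig. 3; Abrams–Gay–Kirby, Fig. 1) is the connected sum of the three of these
(`TrisectionKernels.stabilize_eq_stabilizeOne`).
[cite: GayKirby2016, proof of Lemma 10 (arXiv pp. 31–32, Figs. 27–28) and Fig. 3] -/
def unbalancedKernels (i : Fin 3) : TrisectionKernels 1 :=
  fun ι => normalClosure {PresentedGroup.of (((0 : Fin 1), decide (ι = i)) : surfaceGen 1)}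

/-- Unfolding `unbalancedKernels`. [folklore] -/
theorem unbalancedKernels_apply (i ι : Fin 3) :
    unbalancedKernels i ι =
      normalClosure {PresentedGroup.of (((0 : Fin 1), decide (ι = i)) : surfaceGen 1)} := rfl

/-- The preimage of a slot of `unbalancedKernels i` in `F⟨a, b⟩` is the normal closure of the
killed generator and the relator `[a, b]`. [folklore] -/
theorem preimage_mk_unbalancedKernels (i ι : Fin 3) :
    (PresentedGroup.mk _) ⁻¹' (unbalancedKernels i ι : Set (SurfaceGroup 1)) =
      (normalClosure ({FreeGroup.of (((0 : Fin 1), decide (ι = i)) : surfaceGen 1)} ∪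
          {surfaceRelator 1}) : Set (FreeGroup (surfaceGen 1))) := by
  rw [unbalancedKernels_apply, ← Subgroup.coe_comap, ← comap_mk_normalClosure_image,
    Set.image_singleton]
  rfl

/-- **The unbalanced stabilisation of a kernel triple** in sector `i`: the connected sum with
`unbalancedKernels i` (genus `g ↦ g + 1`; Gay–Kirby, proof of Lemma 10, one eye).
[cite: GayKirby2016, proof of Lemma 10 (arXiv pp. 31–32)] [cite: AbramsGayKirby2018, Def. 2 (p. 1539)] -/
def TrisectionKernels.stabilizeOne (K : TrisectionKernels g) (i : Fin 3) :
    TrisectionKernels (g + 1) :=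
  K.connectSum (unbalancedKernels i)

/-- Unfolding `stabilizeOne`. [folklore] -/
theorem TrisectionKernels.stabilizeOne_eq_connectSum (K : TrisectionKernels g) (i : Fin 3) :
    K.stabilizeOne i = K.connectSum (unbalancedKernels i) := rfl

/-- **Normal generators of an unbalanced stabilisation**: `(K.stabilizeOne i)_ι` is the normal
closure of the lifts of `K_ι` on the first `g` handles and ONE new generator, `b_{g}` if `ι = i`
and `a_{g}` otherwise (the relator `[a_g, b_g]` of the new handle is absorbed:
`ι(r_g) · σ(r_1) = 1` and `r_g` lifts `1 ∈ K_ι`). [cite: GayKirby2016, proof of Lemma 10 (arXiv pp. 31–32)] -/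
theorem TrisectionKernels.stabilizeOne_apply_eq (K : TrisectionKernels g) (i ι : Fin 3) :
    K.stabilizeOne i ι = normalClosure
      ((PresentedGroup.mk _ ∘ genInclAdd g 1) ''
          ((PresentedGroup.mk _) ⁻¹' (K ι : Set (SurfaceGroup g))) ∪
        {PresentedGroup.mk _ (genShiftAdd g 1
          (FreeGroup.of (((0 : Fin 1), decide (ι = i)) : surfaceGen 1)))}) := by
  rw [TrisectionKernels.stabilizeOne_eq_connectSum,
    K.connectSum_apply_eq_of_preimage_eq _ ι (preimage_mk_unbalancedKernels i ι),
    Set.image_union, Set.image_singleton, Set.image_singleton, ← Set.union_assoc]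
  refine normalClosure_union_singleton_eq_of_mem ?_
  -- `σ(r_1) = ι(r_g)⁻¹` and `ι(r_g)` is among the lifted generators of `K_ι` (`r_g ↦ 1 ∈ K_ι`)
  have hrg : surfaceRelator g ∈ (PresentedGroup.mk _) ⁻¹' (K ι : Set (SurfaceGroup g)) := by
    have h0 : PresentedGroup.mk ({surfaceRelator g} : Set (FreeGroup (surfaceGen g)))
        (surfaceRelator g) = 1 :=
      (PresentedGroup.mk_eq_one_iff).2 (subset_normalClosure (Set.mem_singleton _))
    rw [Set.mem_preimage, SetLike.mem_coe, h0]
    exact one_mem _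
  have h1 : (PresentedGroup.mk _ ∘ genShiftAdd g 1) (surfaceRelator 1) =
      ((PresentedGroup.mk _ ∘ genInclAdd g 1) (surfaceRelator g))⁻¹ :=
    eq_inv_of_mul_eq_one_right (mk_genInclAdd_surfaceRelator_mul_mk_genShiftAdd g 1)
  rw [h1]
  exact inv_mem (subset_normalClosure (Or.inl ⟨_, hrg, rfl⟩))

end Unbalanced

/-! ### The balanced stabilisation is three unbalanced ones -/

section ThreeEyes

variable {g : ℕ}

/-- **The preimage of an unbalanced stabilisation in the free group**: the normal closure of
the lifts of `K_ι` on the first `g` handles, the one killed new generator, and `r_{g+1}`.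
[cite: GayKirby2016, proof of Lemma 10 (arXiv pp. 31–32)] -/
theorem TrisectionKernels.preimage_mk_stabilizeOne (K : TrisectionKernels g) (i ι : Fin 3) :
    (PresentedGroup.mk _) ⁻¹' (K.stabilizeOne i ι : Set (SurfaceGroup (g + 1))) =
      (normalClosure (genInclAdd g 1 '' ((PresentedGroup.mk _) ⁻¹' (K ι : Set (SurfaceGroup g))) ∪
          {genShiftAdd g 1 (FreeGroup.of (((0 : Fin 1), decide (ι = i)) : surfaceGen 1))} ∪
          {surfaceRelator (g + 1)}) : Set (FreeGroup (surfaceGen (g + 1)))) := by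
  rw [TrisectionKernels.stabilizeOne_eq_connectSum,
    K.preimage_mk_connectSum _ ι (preimage_mk_unbalancedKernels i ι), Set.image_union,
    Set.image_singleton, Set.image_singleton]
  -- drop `σ(r_1) = ι(r_g)⁻¹ · r_{g+1}`
  congr 1
  rw [show genInclAdd g 1 '' ((PresentedGroup.mk _) ⁻¹' (K ι : Set (SurfaceGroup g))) ∪
      ({genShiftAdd g 1 (FreeGroup.of (((0 : Fin 1), decide (ι = i)) : surfaceGen 1))} ∪
        {genShiftAdd g 1 (surfaceRelator 1)}) ∪ {surfaceRelator (g + 1)} =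
      (genInclAdd g 1 '' ((PresentedGroup.mk _) ⁻¹' (K ι : Set (SurfaceGroup g))) ∪
        {genShiftAdd g 1 (FreeGroup.of (((0 : Fin 1), decide (ι = i)) : surfaceGen 1))} ∪
        {surfaceRelator (g + 1)}) ∪ {genShiftAdd g 1 (surfaceRelator 1)} by
    ext x; simp only [Set.mem_union, Set.mem_singleton_iff]; tauto]
  refine normalClosure_union_singleton_eq_of_mem ?_
  have hrg : surfaceRelator g ∈ (PresentedGroup.mk _) ⁻¹' (K ι : Set (SurfaceGroup g)) := by
    have h0 : PresentedGroup.mk ({surfaceRelator g} : Set (FreeGroup (surfaceGen g)))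
        (surfaceRelator g) = 1 :=
      (PresentedGroup.mk_eq_one_iff).2 (subset_normalClosure (Set.mem_singleton _))
    rw [Set.mem_preimage, SetLike.mem_coe, h0]
    exact one_mem _
  have h1 : genShiftAdd g 1 (surfaceRelator 1) =
      (genInclAdd g 1 (surfaceRelator g))⁻¹ * surfaceRelator (g + 1) := by
    rw [surfaceRelator_add, inv_mul_cancel_left]
  rw [h1]
  exact mul_mem (inv_mem (subset_normalClosure (Or.inl (Or.inl ⟨_, hrg, rfl⟩))))
    (subset_normalClosure (Or.inr rfl))

/-- Three unbalanced inclusions compose to `genIncl`. [folklore] -/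
theorem genInclAdd_comp_genInclAdd_comp_genInclAdd (g : ℕ) :
    (genInclAdd (g + 1 + 1) 1).comp ((genInclAdd (g + 1) 1).comp (genInclAdd g 1)) = genIncl g := by
  refine FreeGroup.ext_hom _ _ fun p => ?_
  simp only [MonoidHom.comp_apply, genInclAdd_of, genIncl_of]
  congr 1

/-- The first new handle is handle `g`: `ι ι σ (x₀) = σ₃ (x₀)`. [folklore] -/
theorem genInclAdd_genInclAdd_genShiftAdd_of (g : ℕ) (b : Bool) :
    genInclAdd (g + 1 + 1) 1 (genInclAdd (g + 1) 1 (genShiftAdd g 1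
      (FreeGroup.of (((0 : Fin 1), b) : surfaceGen 1)))) =
      genShift g (FreeGroup.of (((0 : Fin 3), b) : surfaceGen 3)) := by
  simp only [genInclAdd_of, genShiftAdd_of, genShift_of]
  congr 1

/-- The second new handle is handle `g + 1`: `ι σ (x₀) = σ₃ (x₁)`. [folklore] -/
theorem genInclAdd_genShiftAdd_of (g : ℕ) (b : Bool) :
    genInclAdd (g + 1 + 1) 1 (genShiftAdd (g + 1) 1 (FreeGroup.of (((0 : Fin 1), b) : surfaceGen 1))) =
      genShift g (FreeGroup.of (((1 : Fin 3), b) : surfaceGen 3)) := by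
  simp only [genInclAdd_of, genShiftAdd_of, genShift_of]
  congr 1

/-- The third new handle is handle `g + 2`: `σ (x₀) = σ₃ (x₂)`. [folklore] -/
theorem genShiftAdd_of_eq_genShift (g : ℕ) (b : Bool) :
    genShiftAdd (g + 1 + 1) 1 (FreeGroup.of (((0 : Fin 1), b) : surfaceGen 1)) =
      genShift g (FreeGroup.of (((2 : Fin 3), b) : surfaceGen 3)) := by
  simp only [genShiftAdd_of, genShift_of]
  congr 1

/-- The three new killed generators are exactly the cut curves `s4Gens ι` of the genus-`3`
trisection of `S⁴`. [cite: GayKirby2016, Fig. 3] -/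
theorem mem_s4Gens_iff (ι : Fin 3) (q : surfaceGen 3) :
    q ∈ s4Gens ι ↔ q = ((0 : Fin 3), decide (ι = 2)) ∨ q = ((1 : Fin 3), decide (ι = 1)) ∨
      q = ((2 : Fin 3), decide (ι = 0)) := by
  fin_cases ι <;> fin_cases q <;> simp (config := { decide := true })

/-- The image of `r_1 = [a, b]` on a new handle lies in the normal closure of either new
generator of that handle. [folklore] -/
theorem map_surfaceRelator_one_mem_normalClosure {G : Type*} [Group G]
    (f : FreeGroup (surfaceGen 1) →* G) (b : Bool) :
    f (surfaceRelator 1) ∈ normalClosure {f (FreeGroup.of (((0 : Fin 1), b) : surfaceGen 1))} := by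
  rw [surfaceRelator_one, map_mul, map_mul, map_mul, map_inv, map_inv]
  cases b
  · exact mul_mul_inv_mul_inv_mem_normalClosure_left _ _
  · exact mul_mul_inv_mul_inv_mem_normalClosure_right _ _

/-- **The balanced stabilisation is three unbalanced ones** (Gay–Kirby, proof of Lemma 10:
"Repeat this for each of the three eyes"): stabilising sector `2`, then sector `1`, then
sector `0` — appending the handles `g`, `g + 1`, `g + 2` — gives `K.stabilize` ON THE NOSE
(the `S⁴` triple kills `b` of handle `0` in slot `2`, of handle `1` in slot `1`, of handle `2`
in slot `0`, and `a` elsewhere: `⟪a₁,a₂,b₃⟫, ⟪a₁,b₂,a₃⟫, ⟪b₁,a₂,a₃⟫`).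
[cite: GayKirby2016, proof of Lemma 10 (arXiv pp. 31–32) and Fig. 3]
[cite: AbramsGayKirby2018, Def. 3 (p. 1540) and Fig. 1] -/
theorem TrisectionKernels.stabilize_eq_stabilizeOne (K : TrisectionKernels g) :
    K.stabilize = ((K.stabilizeOne 2).stabilizeOne 1).stabilizeOne 0 := by
  funext ι
  -- `r_g` lifts `1 ∈ K_ι`
  have hrg : surfaceRelator g ∈ (PresentedGroup.mk _) ⁻¹' (K ι : Set (SurfaceGroup g)) := by
    have h0 : PresentedGroup.mk ({surfaceRelator g} : Set (FreeGroup (surfaceGen g)))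
        (surfaceRelator g) = 1 :=
      (PresentedGroup.mk_eq_one_iff).2 (subset_normalClosure (Set.mem_singleton _))
    rw [Set.mem_preimage, SetLike.mem_coe, h0]
    exact one_mem _
  -- descriptions of the three levels and of the left-hand side
  have eK₁ := K.stabilizeOne_apply_eq 2 ι
  have epre₁ := K.preimage_mk_stabilizeOne 2 ι
  have eK₂ := (K.stabilizeOne 2).stabilizeOne_apply_eq 1 ι
  have epre₂ := (K.stabilizeOne 2).preimage_mk_stabilizeOne 1 ι
  have eK₃ := ((K.stabilizeOne 2).stabilizeOne 1).stabilizeOne_apply_eq 0 ι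
  have eL : K.stabilize ι = normalClosure
      ((PresentedGroup.mk _ ∘ genIncl g) '' ((PresentedGroup.mk _) ⁻¹' (K ι : Set (SurfaceGroup g))) ∪
        (PresentedGroup.mk _ ∘ genShift g) ''
          ((PresentedGroup.mk _) ⁻¹' (s4Kernels ι : Set (SurfaceGroup 3)))) := rfl
  set K₁ := K.stabilizeOne 2 with hK₁
  set K₂ := K₁.stabilizeOne 1 with hK₂
  set T : Set (FreeGroup (surfaceGen g)) :=
    (PresentedGroup.mk _) ⁻¹' (K ι : Set (SurfaceGroup g)) with hT
  set pre₁ : Set (FreeGroup (surfaceGen (g + 1))) :=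
    (PresentedGroup.mk _) ⁻¹' (K₁ ι : Set (SurfaceGroup (g + 1))) with hpre₁
  set pre₂ : Set (FreeGroup (surfaceGen (g + 1 + 1))) :=
    (PresentedGroup.mk _) ⁻¹' (K₂ ι : Set (SurfaceGroup (g + 1 + 1))) with hpre₂
  haveI iL : (K.stabilize ι).Normal := TrisectionKernels.connectSum_normal K s4Kernels ι
  haveI iR : (K₂.stabilizeOne 0 ι).Normal := TrisectionKernels.connectSum_normal K₂ _ ι
  -- the three inclusions compose to `genIncl`, read in `S_{g+3}`
  have hI1 : ∀ t : FreeGroup (surfaceGen g),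
      PresentedGroup.mk ({surfaceRelator (g + 1 + 1 + 1)} : Set (FreeGroup (surfaceGen (g + 1 + 1 + 1))))
          (genInclAdd (g + 1 + 1) 1 (genInclAdd (g + 1) 1 (genInclAdd g 1 t))) =
        (PresentedGroup.mk ({surfaceRelator (g + 3)} : Set (FreeGroup (surfaceGen (g + 3)))) ∘
          genIncl g) t := by
    intro t
    show _ = PresentedGroup.mk _ (genIncl g t)
    rw [← genInclAdd_comp_genInclAdd_comp_genInclAdd g]
    rfl
  -- ### membership chains towards the right-hand side
  have hT3 : ∀ t ∈ T, PresentedGroup.mk ({surfaceRelator (g + 1 + 1 + 1)} :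
        Set (FreeGroup (surfaceGen (g + 1 + 1 + 1))))
      (genInclAdd (g + 1 + 1) 1 (genInclAdd (g + 1) 1 (genInclAdd g 1 t))) ∈ K₂.stabilizeOne 0 ι := by
    intro t ht
    have m1 : PresentedGroup.mk _ (genInclAdd g 1 t) ∈ K₁ ι := by
      rw [eK₁]; exact subset_normalClosure (Or.inl ⟨t, ht, rfl⟩)
    have m2 : PresentedGroup.mk _ (genInclAdd (g + 1) 1 (genInclAdd g 1 t)) ∈ K₂ ι := by
      rw [eK₂]; exact subset_normalClosure (Or.inl ⟨_, m1, rfl⟩)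
    rw [eK₃]; exact subset_normalClosure (Or.inl ⟨_, m2, rfl⟩)
  have hx₂R : PresentedGroup.mk ({surfaceRelator (g + 1 + 1 + 1)} :
        Set (FreeGroup (surfaceGen (g + 1 + 1 + 1))))
      (genInclAdd (g + 1 + 1) 1 (genInclAdd (g + 1) 1 (genShiftAdd g 1
        (FreeGroup.of (((0 : Fin 1), decide (ι = 2)) : surfaceGen 1))))) ∈ K₂.stabilizeOne 0 ι := by
    have n1 : PresentedGroup.mk _ (genShiftAdd g 1
        (FreeGroup.of (((0 : Fin 1), decide (ι = 2)) : surfaceGen 1))) ∈ K₁ ι := by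
      rw [eK₁]; exact subset_normalClosure (Or.inr rfl)
    have n2 : PresentedGroup.mk _ (genInclAdd (g + 1) 1 (genShiftAdd g 1
        (FreeGroup.of (((0 : Fin 1), decide (ι = 2)) : surfaceGen 1)))) ∈ K₂ ι := by
      rw [eK₂]; exact subset_normalClosure (Or.inl ⟨_, n1, rfl⟩)
    rw [eK₃]; exact subset_normalClosure (Or.inl ⟨_, n2, rfl⟩)
  have hx₁R : PresentedGroup.mk ({surfaceRelator (g + 1 + 1 + 1)} :
        Set (FreeGroup (surfaceGen (g + 1 + 1 + 1))))
      (genInclAdd (g + 1 + 1) 1 (genShiftAdd (g + 1) 1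
        (FreeGroup.of (((0 : Fin 1), decide (ι = 1)) : surfaceGen 1)))) ∈ K₂.stabilizeOne 0 ι := by
    have p2 : PresentedGroup.mk _ (genShiftAdd (g + 1) 1
        (FreeGroup.of (((0 : Fin 1), decide (ι = 1)) : surfaceGen 1))) ∈ K₂ ι := by
      rw [eK₂]; exact subset_normalClosure (Or.inr rfl)
    rw [eK₃]; exact subset_normalClosure (Or.inl ⟨_, p2, rfl⟩)
  have hx₀R : PresentedGroup.mk ({surfaceRelator (g + 1 + 1 + 1)} :
        Set (FreeGroup (surfaceGen (g + 1 + 1 + 1))))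
      (genShiftAdd (g + 1 + 1) 1 (FreeGroup.of (((0 : Fin 1), decide (ι = 0)) : surfaceGen 1))) ∈
        K₂.stabilizeOne 0 ι := by
    rw [eK₃]; exact subset_normalClosure (Or.inr rfl)
  -- ### membership facts towards the left-hand side
  have hgenL : ∀ q ∈ s4Gens ι, (PresentedGroup.mk ({surfaceRelator (g + 3)} :
        Set (FreeGroup (surfaceGen (g + 3)))) ∘ genShift g) (FreeGroup.of q) ∈ K.stabilize ι := by
    intro q hq
    rw [eL]
    refine subset_normalClosure (Or.inr ⟨FreeGroup.of q, ?_, rfl⟩)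
    exact of_mem_s4Kernels ι hq
  have hTL : ∀ t ∈ T, (PresentedGroup.mk ({surfaceRelator (g + 3)} :
        Set (FreeGroup (surfaceGen (g + 3)))) ∘ genIncl g) t ∈ K.stabilize ι := by
    intro t ht
    rw [eL]
    exact subset_normalClosure (Or.inl ⟨t, ht, rfl⟩)
  -- the three new generators, read on the left
  have hx₂L : PresentedGroup.mk ({surfaceRelator (g + 1 + 1 + 1)} :
        Set (FreeGroup (surfaceGen (g + 1 + 1 + 1))))
      (genInclAdd (g + 1 + 1) 1 (genInclAdd (g + 1) 1 (genShiftAdd g 1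
        (FreeGroup.of (((0 : Fin 1), decide (ι = 2)) : surfaceGen 1))))) ∈ K.stabilize ι := by
    rw [genInclAdd_genInclAdd_genShiftAdd_of g]
    exact hgenL _ ((mem_s4Gens_iff ι _).2 (Or.inl rfl))
  have hx₁L : PresentedGroup.mk ({surfaceRelator (g + 1 + 1 + 1)} :
        Set (FreeGroup (surfaceGen (g + 1 + 1 + 1))))
      (genInclAdd (g + 1 + 1) 1 (genShiftAdd (g + 1) 1
        (FreeGroup.of (((0 : Fin 1), decide (ι = 1)) : surfaceGen 1)))) ∈ K.stabilize ι := by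
    rw [genInclAdd_genShiftAdd_of g]
    exact hgenL _ ((mem_s4Gens_iff ι _).2 (Or.inr (Or.inl rfl)))
  have hx₀L : PresentedGroup.mk ({surfaceRelator (g + 1 + 1 + 1)} :
        Set (FreeGroup (surfaceGen (g + 1 + 1 + 1))))
      (genShiftAdd (g + 1 + 1) 1 (FreeGroup.of (((0 : Fin 1), decide (ι = 0)) : surfaceGen 1))) ∈
        K.stabilize ι := by
    rw [genShiftAdd_of_eq_genShift g]
    exact hgenL _ ((mem_s4Gens_iff ι _).2 (Or.inr (Or.inr rfl)))
  -- the relators of the intermediate levels, read on the left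
  have hr₁L : PresentedGroup.mk ({surfaceRelator (g + 1 + 1 + 1)} :
        Set (FreeGroup (surfaceGen (g + 1 + 1 + 1))))
      (genInclAdd (g + 1 + 1) 1 (genInclAdd (g + 1) 1 (surfaceRelator (g + 1)))) ∈ K.stabilize ι := by
    rw [surfaceRelator_add g 1, map_mul, map_mul, map_mul]
    refine mul_mem ?_ ?_
    · rw [hI1]; exact hTL _ hrg
    · have := map_surfaceRelator_one_mem_normalClosure
        (((PresentedGroup.mk ({surfaceRelator (g + 1 + 1 + 1)} :
          Set (FreeGroup (surfaceGen (g + 1 + 1 + 1))))).comp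
          ((genInclAdd (g + 1 + 1) 1).comp (genInclAdd (g + 1) 1))).comp (genShiftAdd g 1))
        (decide (ι = 2))
      exact normalClosure_le_normal (Set.singleton_subset_iff.2 hx₂L) this
  have hr₂L : PresentedGroup.mk ({surfaceRelator (g + 1 + 1 + 1)} :
        Set (FreeGroup (surfaceGen (g + 1 + 1 + 1))))
      (genInclAdd (g + 1 + 1) 1 (surfaceRelator (g + 1 + 1))) ∈ K.stabilize ι := by
    rw [surfaceRelator_add (g + 1) 1, map_mul, map_mul]
    refine mul_mem hr₁L ?_
    have := map_surfaceRelator_one_mem_normalClosure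
      (((PresentedGroup.mk ({surfaceRelator (g + 1 + 1 + 1)} :
        Set (FreeGroup (surfaceGen (g + 1 + 1 + 1))))).comp
        (genInclAdd (g + 1 + 1) 1)).comp (genShiftAdd (g + 1) 1)) (decide (ι = 1))
    exact normalClosure_le_normal (Set.singleton_subset_iff.2 hx₁L) this
  -- ### the two inclusions
  apply le_antisymm
  · -- `K.stabilize ι ≤` three eyes
    rw [eL]
    refine normalClosure_le_normal ?_
    rintro _ (⟨t, ht, rfl⟩ | ⟨w, hw, rfl⟩)
    · rw [SetLike.mem_coe, ← hI1 t]
      exact hT3 t ht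
    · rw [preimage_mk_s4Kernels] at hw
      refine (normalClosure_le_normal (N := (K₂.stabilizeOne 0 ι).comap
        ((PresentedGroup.mk _).comp (genShift g))) ?_) hw
      rintro _ (⟨q, hq, rfl⟩ | hq)
      · rw [Finset.mem_coe, mem_s4Gens_iff] at hq
        rw [SetLike.mem_coe, Subgroup.mem_comap, MonoidHom.comp_apply]
        rcases hq with rfl | rfl | rfl
        · rw [← genInclAdd_genInclAdd_genShiftAdd_of g]; exact hx₂R
        · rw [← genInclAdd_genShiftAdd_of g]; exact hx₁R
        · rw [← genShiftAdd_of_eq_genShift g]; exact hx₀R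
      · rw [Set.mem_singleton_iff] at hq
        subst hq
        rw [SetLike.mem_coe, Subgroup.mem_comap, MonoidHom.comp_apply,
          eq_inv_of_mul_eq_one_right (mk_genIncl_surfaceRelator_mul_mk_genShift g)]
        refine inv_mem ?_
        have := hT3 _ hrg
        rwa [hI1] at this
  · -- three eyes `≤ K.stabilize ι`
    rw [eK₃]
    refine normalClosure_le_normal ?_
    rintro _ (⟨w, hw, rfl⟩ | hw)
    · rw [epre₂] at hw
      refine (normalClosure_le_normal (N := (K.stabilize ι).comap
        ((PresentedGroup.mk _).comp (genInclAdd (g + 1 + 1) 1))) ?_) hw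
      rintro _ ((⟨w₁, hw₁, rfl⟩ | hw₁) | hw₁)
      · rw [epre₁] at hw₁
        refine (normalClosure_le_normal (N := (K.stabilize ι).comap
          ((PresentedGroup.mk _).comp ((genInclAdd (g + 1 + 1) 1).comp (genInclAdd (g + 1) 1)))) ?_) hw₁
        rintro _ ((⟨t, ht, rfl⟩ | ht) | ht)
        · rw [SetLike.mem_coe, Subgroup.mem_comap, MonoidHom.comp_apply, MonoidHom.comp_apply, hI1]
          exact hTL t ht
        · rw [Set.mem_singleton_iff] at ht
          subst ht
          rw [SetLike.mem_coe, Subgroup.mem_comap, MonoidHom.comp_apply, MonoidHom.comp_apply]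
          exact hx₂L
        · rw [Set.mem_singleton_iff] at ht
          subst ht
          rw [SetLike.mem_coe, Subgroup.mem_comap, MonoidHom.comp_apply, MonoidHom.comp_apply]
          exact hr₁L
      · rw [Set.mem_singleton_iff] at hw₁
        subst hw₁
        rw [SetLike.mem_coe, Subgroup.mem_comap, MonoidHom.comp_apply]
        exact hx₁L
      · rw [Set.mem_singleton_iff] at hw₁
        subst hw₁
        rw [SetLike.mem_coe, Subgroup.mem_comap, MonoidHom.comp_apply]
        exact hr₂L
    · rw [Set.mem_singleton_iff] at hw
      subst hw
      exact hx₀L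

end ThreeEyes

end Literature.Topology.FourManifolds
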